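import Mathlib
import Summits.MatrixMultiplication.MatrixMultiplication.Theses.HiddenToeplitzCorners

/-!
# Two-sided (adjugate) certificates have an injective kernel map — `N ≥ r²`
(crux `HiddenCorners`, stmt-MatrixMultiplication-7492, line `birth`, stub `stub_adjugate_family`;
paper: `Cruxes/HiddenCorners/KroneckerNeutral.md`, Theorem 4)

By Lemma (★) of the note (paper, representation theory), the stub's certificate `T(X)·K·vec(adj X) = 0 on {det X = 0}`
is equivalent to the TWO-SIDED identity `T(X) K vec(M) = L vec(XM) + L' vec(MX)` for all `X, M`.  This file proves the
structural consequence from the two-sided identity (taken as the hypothesis): for a generically nonsingular pencil and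
a Segre-injective `K` (nonzero on pure tensors), `K` is injective, hence `r² ≤ N`.  Proof: if `K vec W = 0` then
`T(X) K vec(WXW) = L vec(XWXW) + L' vec(WXWX) = T(XWX) K vec(W) = 0` for all `X`; the linear map
`f(X) = K vec(WXW)` with `T(X) f(X) = 0` for all `X` vanishes identically once some `T(X₀)` is invertible (polarise:
`T(X₀) f(X₀) = 0`, then `T(X₀) f(X) = −T(X) f(X₀) = 0`); but `f(p qᵀ) = K vec((Wp)(Wᵀq)ᵀ)` is `K` of a nonzero pure tensor.
-/

set_option linter.dupNamespace false

namespace Summit.MatrixMultiplication.MatrixMultiplication.Theorems.KroneckerNeutral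

open scoped BigOperators Matrix

variable {r N : ℕ}

/-- The pencil `X ↦ Σ X_ab • T_ab` is additive in `X`. -/
theorem pencil_add (T : Fin r → Fin r → Matrix (Fin N) (Fin N) ℂ) (X Y : Matrix (Fin r) (Fin r) ℂ) :
    (∑ a : Fin r, ∑ b : Fin r, (X + Y) a b • T a b)
      = (∑ a : Fin r, ∑ b : Fin r, X a b • T a b) + ∑ a : Fin r, ∑ b : Fin r, Y a b • T a b := by
  simp only [Matrix.add_apply, add_smul, Finset.sum_add_distrib]

/-- `vec (W (p qᵀ) W)` is the pure tensor `(W p) ⊗ (Wᵀ q)`. -/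
theorem vec_mul_vecMulVec_mul (W : Matrix (Fin r) (Fin r) ℂ) (p q : Fin r → ℂ) (c : Fin r × Fin r) :
    (W * Matrix.vecMulVec p q * W) c.1 c.2 = (W *ᵥ p) c.1 * (Wᵀ *ᵥ q) c.2 := by
  rw [Matrix.mul_vecMulVec, Matrix.vecMulVec_mul, Matrix.vecMulVec_apply, Matrix.mulVec_transpose]

/-- **Theorem 4 (two-sided form).**  A generically nonsingular pencil with a Segre-injective two-sided kernel map
`K` (`T(X) K vec M = L vec(XM) + L' vec(MX)` for all `X, M`) has `K` injective on ALL of `ℂ^(r×r)`: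
`K vec W = 0` forces `W = 0`. -/
theorem twoSided_kernelMap_eq_zero (T : Fin r → Fin r → Matrix (Fin N) (Fin N) ℂ)
    (K L L' : Matrix (Fin N) (Fin r × Fin r) ℂ)
    (hK : ∀ v w : Fin r → ℂ, v ≠ 0 → w ≠ 0 → K *ᵥ (fun c : Fin r × Fin r => v c.1 * w c.2) ≠ 0)
    (h2 : ∀ X M : Matrix (Fin r) (Fin r) ℂ,
      (∑ a : Fin r, ∑ b : Fin r, X a b • T a b) *ᵥ (K *ᵥ fun c : Fin r × Fin r => M c.1 c.2)
        = L *ᵥ (fun c : Fin r × Fin r => (X * M) c.1 c.2) + L' *ᵥ (fun c : Fin r × Fin r => (M * X) c.1 c.2))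
    (hX₀ : ∃ X₀ : Matrix (Fin r) (Fin r) ℂ, (∑ a : Fin r, ∑ b : Fin r, X₀ a b • T a b).det ≠ 0)
    (W : Matrix (Fin r) (Fin r) ℂ) (hW : K *ᵥ (fun c : Fin r × Fin r => W c.1 c.2) = 0) :
    W = 0 := by
  classical
  by_contra hW0
  -- notation for the pencil and the linear map f(X) = K vec(W X W)
  set P : Matrix (Fin r) (Fin r) ℂ → Matrix (Fin N) (Fin N) ℂ := fun X => ∑ a : Fin r, ∑ b : Fin r, X a b • T a b
    with hP
  set f : Matrix (Fin r) (Fin r) ℂ → (Fin N → ℂ) := fun X => K *ᵥ fun c : Fin r × Fin r => (W * X * W) c.1 c.2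
    with hf
  -- f is additive
  have fadd : ∀ X Y, f (X + Y) = f X + f Y := by
    intro X Y
    simp only [hf, Matrix.mul_add, Matrix.add_mul, ← Matrix.mulVec_add]
    congr 1
  -- T(X) f(X) = 0 for all X
  have key : ∀ X, P X *ᵥ f X = 0 := by
    intro X
    have h1 := h2 X (W * X * W)
    have h0 := h2 (X * W * X) W
    rw [hW, Matrix.mulVec_zero] at h0
    simp only [hP, hf]
    rw [h1]
    have e1 : X * (W * X * W) = X * W * X * W := by simp only [Matrix.mul_assoc]
    have e2 : W * X * W * X = W * (X * W * X) := by simp only [Matrix.mul_assoc]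
    rw [e1, e2]
    exact h0.symm
  -- polarisation: f ≡ 0
  obtain ⟨X₀, hX₀⟩ := hX₀
  have hinj : Function.Injective (P X₀).mulVec :=
    Matrix.mulVec_injective_iff_isUnit.mpr ((Matrix.isUnit_iff_isUnit_det _).mpr (isUnit_iff_ne_zero.mpr hX₀))
  have polar : ∀ X Y, P X *ᵥ f Y + P Y *ᵥ f X = 0 := by
    intro X Y
    have h := key (X + Y)
    rw [show P (X + Y) = P X + P Y from pencil_add T X Y, fadd, Matrix.add_mulVec, Matrix.mulVec_add,
      Matrix.mulVec_add, key X, key Y, zero_add, add_zero] at h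
    exact h
  have fX₀ : f X₀ = 0 := by
    have h := polar X₀ X₀
    rw [← two_smul ℂ, smul_eq_zero] at h
    rcases h with h | h
    · norm_num at h
    · exact hinj (by rw [h, Matrix.mulVec_zero])
  have fzero : ∀ X, f X = 0 := by
    intro X
    have h := polar X₀ X
    rw [fX₀, Matrix.mulVec_zero, add_zero] at h
    exact hinj (by rw [h, Matrix.mulVec_zero])
  -- a nonzero pure tensor in ker K
  obtain ⟨i, j, hij⟩ : ∃ i j, W i j ≠ 0 := by
    by_contra h; push Not at h; exact hW0 (Matrix.ext fun i j => h i j)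
  have hv : W *ᵥ (Pi.single j 1) ≠ 0 := by
    intro h; apply hij; simpa [Matrix.mulVec_single_one] using congrFun h i
  have hw : Wᵀ *ᵥ (Pi.single i 1) ≠ 0 := by
    intro h; apply hij; simpa [Matrix.mulVec_single_one] using congrFun h j
  apply hK _ _ hv hw
  have h := fzero (Matrix.vecMulVec (Pi.single j 1) (Pi.single i 1))
  simp only [hf] at h
  rw [← h]
  congr 1
  funext c
  rw [vec_mul_vecMulVec_mul]

/-- **Corollary (`N ≥ r²`).**  Under the hypotheses of `twoSided_kernelMap_eq_zero`, `r² ≤ N`: the kernel map is an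
injection `ℂ^(r×r) → ℂ^N`. -/
theorem twoSided_sq_le_size (T : Fin r → Fin r → Matrix (Fin N) (Fin N) ℂ)
    (K L L' : Matrix (Fin N) (Fin r × Fin r) ℂ)
    (hK : ∀ v w : Fin r → ℂ, v ≠ 0 → w ≠ 0 → K *ᵥ (fun c : Fin r × Fin r => v c.1 * w c.2) ≠ 0)
    (h2 : ∀ X M : Matrix (Fin r) (Fin r) ℂ,
      (∑ a : Fin r, ∑ b : Fin r, X a b • T a b) *ᵥ (K *ᵥ fun c : Fin r × Fin r => M c.1 c.2)
        = L *ᵥ (fun c : Fin r × Fin r => (X * M) c.1 c.2) + L' *ᵥ (fun c : Fin r × Fin r => (M * X) c.1 c.2))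
    (hX₀ : ∃ X₀ : Matrix (Fin r) (Fin r) ℂ, (∑ a : Fin r, ∑ b : Fin r, X₀ a b • T a b).det ≠ 0) :
    r ^ 2 ≤ N := by
  classical
  have hinj : Function.Injective K.mulVecLin := by
    intro x y hxy
    have h : K *ᵥ (x - y) = 0 := by
      rw [Matrix.mulVec_sub, sub_eq_zero]; exact hxy
    have hfun : (fun c : Fin r × Fin r => (Matrix.of fun i j : Fin r => (x - y) (i, j)) c.1 c.2) = x - y := by
      funext c; simp
    have hW := twoSided_kernelMap_eq_zero T K L L' hK h2 hX₀ (Matrix.of fun i j : Fin r => (x - y) (i, j))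
      (by rw [hfun]; exact h)
    have : x - y = 0 := by
      funext c
      have := congrFun (congrFun hW c.1) c.2
      simpa using this
    exact sub_eq_zero.mp this
  have h := LinearMap.finrank_le_finrank_of_injective hinj
  simp only [Module.finrank_fintype_fun_eq_card, Fintype.card_prod, Fintype.card_fin] at h
  nlinarith [h]

end Summit.MatrixMultiplication.MatrixMultiplication.Theorems.KroneckerNeutral
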